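import Literature.MathematicalPhysics.QuantumFieldTheory.Balaban1983to89.B9B8KnitLetterResolvent
import Literature.MathematicalPhysics.QuantumFieldTheory.Balaban1983to89.B9Eq3104CutoffCommutators

/-!
# `Balaban1983to89.B9B8KnitBondResolvent` — THE BOND-SECTOR KNIT∕TAXICAB JUNCTION, FILE 1 (ALGEBRA): [Balaban1985BackgroundPropagators] (3.26)'s `Δ_a(U)` AT
# TWO SITE-TRANSPORTER LETTERS DIFFERS BY `D_U(R₁ − R₂)D*_U` ONLY; the five-term telescope of `R₁ − R₂` through the (3.25) word `G′Q′*(Q′G′²Q′*)⁻¹Q′G′`; the two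
# resolvent identities for `G_a = Δ_a⁻¹` ([4] (2.50)); the member identity `G₁F = G₂(F + D(R₂ − R₁)D*·G₁F)`; and the invertibility transfer
# `Δ₂, 1 + G₂E units ⇒ Δ₁ = Δ₂ + E a unit` ((3.106) «G = G₀(I − R)⁻¹») — the bond-sector twin of junction J-B file 8 `B9B8KnitLetterResolvent`

statement-level skeleton of published theorems with citation tags; proofs where landed; nothing here is a claim about the Yang–Mills mass gap

T. Bałaban, *Propagators for lattice gauge theories in a background field*, Commun. Math. Phys. **99** (1985) 389–434 [`Balaban1985BackgroundPropagators`, "[B9]"]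
(PDF held: `paper:balaban1985-cmp99-background-propagators`, journal page = PDF page + 388): (3.19) p. 393 (the averaging operators' transporters «defined by (52),
(53) in [5]» — the knit letter `parKnitY`), (3.40) p. 397 («Γ_{x,x′} denote a shortest contour» — def-Y's letter of record `parSymY`), (3.25) p. 395
«Rf = (I − G′Q′*(Q′G′²Q′*)⁻¹Q′G′)f, where G′ = G′(U) = (Δ′_a)⁻¹», (3.26) p. 395 «Δ_a(U) = Δ(U) + D_U R(U) D*_U + Q*(U)aQ(U)» (the tree's `Node00.deltaAY i parS parB Gp U
= hessY + gradY ∘ RY parS Gp ∘ divY + QsY parB ∘ aY ∘ QY parB`), (3.27) p. 395 «G(U) = Δ_a(U)⁻¹», (3.106) p. 414 «G = G₀(I − R)⁻¹ = Σ G₀Rⁿ», Thm 3.11 p. 416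
(«It is a symmetric and invertible operator»).  [4] = T. Bałaban, *Propagators and renormalization transformations for lattice gauge theories. II*, Commun.
Math. Phys. **96** (1984) 223–250 [`Balaban1984PropagatorsII`]: (2.50) p. 232, (2.66) p. 234.  [`Balaban1985RegularSpaces`] (1.38) p. 82, (1.58)–(1.60) pp. 86–87.
Rows B9.Eq3.26 × B9.Eq3.106 (cells only; no row head changes).

WHY THIS FILE (lead g34 RULING JUNCTION-PARS 2026-08-28T23:16Z, STEP 1; design memo `pub/lit-balaban/lit-balaban-t2s-1/g10/JB-BOND-DESIGN.md`).  After G9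
(`B8Thm2TorusCoverOfEBlock`) the [B8] Thm 2 torus interface displays `IsUnit Δ_a` + the (3.42) block of `G_a` (equivalently, G8's four weighted members) at
def-Y's letters with the site transporter `parS := parKnitY i` — FORCED by the knit's Landau condition ((1.38) ⟹ `R(parKnitY)·D*_U a = 0`,
`B9B8KnitLandauTransfer.RY_divY_eq_zero_of_isLandau138`, consumed by r05's `B8Eq158AtLettersY.eq158_atLettersY`).  The G-B9-LETTERS suppliers (M5.1b-G → M5.7) are
typed at `parS := parSymY i`.  In print the two transporter conventions are one object; in the tree they are two letters, compared by junction J-B file 5b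
(`B9B8KnitVsTaxicab.norm_parKnitY_sub_parSymY_le`), and the SITE-sector letters `G′`, `(Q′G′²Q′*)⁻¹` were already transported between them by the resolvent device of
[4] (2.50)∕(2.66) (J-B files 8∕9∕23c, p33).  THIS FILE is the bond-sector twin of file 8's algebra: since `Δ_a` depends on `parS` only through the projection
`R` of (3.25) (the Laplacian `D*_U𝒦D_U + Δ′₂` and the averaging term `Q*aQ`, which reads `parB`, are shared), the two `Δ_a`'s differ by `D_U(R₁ − R₂)D*_U`, the
difference `R₁ − R₂` telescopes through the five letters of the (3.25) word with ONE differenced letter per summand (each priced by a landed J-B file), and the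
resolvent ∕ member ∕ invertibility identities follow by ring algebra.  NO estimate is proved here (files 2+: the weighted bound on `D_U(R_knit − R_sym)D*_U` and the
bootstrap, pending the cell's parS census).

WHAT IS PROVED (all `theorem`s; 0 `def`, 0 `… : Prop` fact, 0 sorry; any coefficient algebra `𝔸`, any `parB`, any two pairs `(parS₁, G′₁)`, `(parS₂, G′₂)`).
* §1 ★ `deltaAY_sub_deltaAY` (`Δ_a(U; parS₁, G′₁) − Δ_a(U; parS₂, G′₂) = gradY U ∘ (RY parS₁ G′₁ U − RY parS₂ G′₂ U) ∘ divY U`) + `_apply`;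
  ★ `deltaAY_sub_deltaAY_eq_DPDsY_sub` ∕ `gradY_RY_sub_divY_eq` (the same perturbation spelled `DPDsY parS₂ G′₂ U − DPDsY parS₁ G′₁ U` with b11's (3.101) letter
  `D_U P D*_U`, `P = 1 − R` — the currency of M5.7's (3.49) ∕ Cor. 3.6 majorants); `RY_sub_RY`;
  `word_sub_word_telescope` (abstract five-term telescope); ★ `RY_sub_RY_telescope` (at the letters `GpY ∕ QpsY ∕ XinvY ∕ QpY`).
* §2 ★ `GAY_eq_of_isUnit` ∕ `GAY_eq_of_isUnit'` (the two resolvent identities for `G_a` at two letters, both `Δ_a`'s units — file 8's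
  `inverse_eq_add_of_isUnit(')` BY NAME; `G·Δ_a = 1 = Δ_a·G` are def-Y's `Node00.OpsYDeltaA.GAY_mul_deltaAY` ∕ `deltaAY_mul_GAY`), ★ `GAY_apply_eq` (`G₁F = G₂(F + D_U((R₂ − R₁)(D*_U(G₁F))))`).
* §3 `add_eq_mul_one_add_inverse`, ★ `isUnit_add_of_isUnit` (any ring: `T`, `1 + T⁻¹E` units ⇒ `T + E` a unit), ★ `isUnit_deltaAY_of_isUnit` (at two letters),
  `isUnit_of_forall_eq_zero` (finite carrier: trivial kernel ⇒ unit, `[FiniteDimensional ℂ 𝔸]`), ★ `isUnit_deltaAY_of_kernel` (`Δ_a(U; parS₂)` a unit and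
  `A + G₂·D_U((R₁ − R₂)(D*_U A)) = 0 ⇒ A = 0` ⇒ `Δ_a(U; parS₁)` a unit — the form a weighted-norm smallness argument delivers).

HONEST SCOPE ∕ NOT CLAIMED.  Ring algebra and linear algebra on the finite bond carrier only; the located smallness of `R_knit − R_sym` (junction J-B files 5b∕8∕9∕23c
give the letter differences; the `D_U … D*_U` sandwich against the (3.41) weights is file 2) and every estimate of [B9]∕[4] are NOT here; nothing landed is modified
(file 8's site-sector identities are reused, not restated); count-neutral; no summit ∕ sub-problem statement is proved; NOT a node discharge; `stub_PV3A` NOT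
discharged; nothing continuum ∕ ℝ⁴ ∕ OS ∕ mass-gap ∕ Clay — the Yang–Mills mass gap is NOT proved by any of this.  No `sorry`, no `axiom`, no `def`, no
`instance`, no `notation`.  NEW file.  RELATED, NOT DUPLICATED (searched 2026-08-28: `lean search 'deltaAY_sub|GAY_eq_of_isUnit|RY_sub_RY|isUnit_add_of_isUnit' --decl`
— only dag-w's Sect. D∕E identities `Node00.OpsYSectDE.deltaPiAY_eq_deltaAY_sub` ∕ `deltaOneY_eq_deltaAY_sub` (other operators) and file 8's site-sector
`deltaPrimeAY_sub_eq` ∕ `GpY_parKnitY_eq(')`).  Cell `lit-balaban`, seat `lit-balaban-t2s-1` gen 10, 2026-08-28; `--supports stmt-QuantumFields-19200`.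
-/

noncomputable section

namespace Literature.MathematicalPhysics.QuantumFieldTheory.Balaban1983to89.B9B8KnitBondResolvent

open Node00
open B6KLevelCensusIndexV1 (KIdx)
open B9B8KnitLetterResolvent (inverse_eq_add_of_isUnit inverse_eq_add_of_isUnit')
open B9Eq3104CutoffCommutators (DPDsY)

variable {d ℓ : ℕ} {hd : 1 ≤ d + 1} {hL : Odd (ℓ + 1) ∧ 1 < ℓ + 1} {b₀ b₁ : ℝ}
variable {𝔸 : Type} [NormedRing 𝔸] [NormedAlgebra ℂ 𝔸] [CompleteSpace 𝔸]
variable (i : KIdx d ℓ hd hL b₀ b₁)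

/-! ## §1 `Δ_a(U; parS₁) − Δ_a(U; parS₂) = D_U ∘ (R(parS₁) − R(parS₂)) ∘ D*_U` and the telescope of `R₁ − R₂` -/

section Difference

/-- ★ **THE TWO `Δ_a`'s DIFFER ONLY IN THE PROJECTION TERM**: at one background `U` and one bond transporter `parB`, for two site transporters ∕ site letters
`(parS₁, G′₁)`, `(parS₂, G′₂)`: `Δ_a(U; parS₁, G′₁) − Δ_a(U; parS₂, G′₂) = D_U ∘ (R(U; parS₁, G′₁) − R(U; parS₂, G′₂)) ∘ D*_U` — the covariant Laplacian `D*_U𝒦D_U + …`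
and the averaging term `Q*(U)aQ(U)` of (3.26) cancel. [cite: Balaban1985BackgroundPropagators, (3.26) p.395, (3.25) p.395] -/
theorem deltaAY_sub_deltaAY (parS₁ parS₂ : SiteParY 𝔸 i) (parB : BondParY 𝔸 i) (Gp₁ Gp₂ : SiteOpY 𝔸 i) (U : CfgY 𝔸 i) :
    deltaAY i parS₁ parB Gp₁ U - deltaAY i parS₂ parB Gp₂ U = gradY i U ∘ₗ (RY i parS₁ Gp₁ U - RY i parS₂ Gp₂ U) ∘ₗ divY i U := by
  rw [deltaAY, deltaAY, LinearMap.sub_comp, LinearMap.comp_sub]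
  abel

/-- the same, applied to a bond function. [cite: Balaban1985BackgroundPropagators, (3.26) p.395] -/
theorem deltaAY_sub_deltaAY_apply (parS₁ parS₂ : SiteParY 𝔸 i) (parB : BondParY 𝔸 i) (Gp₁ Gp₂ : SiteOpY 𝔸 i) (U : CfgY 𝔸 i) (A : FBondY i → 𝔸) :
    deltaAY i parS₁ parB Gp₁ U A - deltaAY i parS₂ parB Gp₂ U A =
      gradY i U (RY i parS₁ Gp₁ U (divY i U A) - RY i parS₂ Gp₂ U (divY i U A)) := by
  rw [← LinearMap.sub_apply, deltaAY_sub_deltaAY]; rfl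

/-- ★ **… EQUIVALENTLY, BY THE NONLOCAL PARTS `D_U P D*_U` OF (3.101)**: `Δ_a(U; parS₁, G′₁) − Δ_a(U; parS₂, G′₂) = D_U P₂ D*_U − D_U P₁ D*_U` with b11's letter
`DPDsY parS Gp U = gradY ∘ (1 − RY parS Gp) ∘ divY` (`P = 1 − R = G′Q′*(Q′G′²Q′*)⁻¹Q′G′`) — the currency of the (3.49)∕Cor. 3.6 majorants of module M5.7 (D2a
`B9Cor36DPDsCubeAtLocCfg`, `B9Eq3104CutoffCommutators`). [cite: Balaban1985BackgroundPropagators, (3.26) p.395, (3.101) p.414 («DPD* has a regular kernel satisfying (3.49)»)] -/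
theorem deltaAY_sub_deltaAY_eq_DPDsY_sub (parS₁ parS₂ : SiteParY 𝔸 i) (parB : BondParY 𝔸 i) (Gp₁ Gp₂ : SiteOpY 𝔸 i) (U : CfgY 𝔸 i) :
    deltaAY i parS₁ parB Gp₁ U - deltaAY i parS₂ parB Gp₂ U = DPDsY i parS₂ Gp₂ U - DPDsY i parS₁ Gp₁ U := by
  rw [deltaAY_sub_deltaAY, DPDsY, DPDsY]
  simp only [LinearMap.comp_sub, LinearMap.sub_comp]
  abel

/-- the perturbation letter of the junction in both spellings: `gradY ∘ (R₁ − R₂) ∘ divY = DPDsY₂ − DPDsY₁`. [cite: Balaban1985BackgroundPropagators, (3.26) p.395, (3.101) p.414] -/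
theorem gradY_RY_sub_divY_eq (parS₁ parS₂ : SiteParY 𝔸 i) (Gp₁ Gp₂ : SiteOpY 𝔸 i) (U : CfgY 𝔸 i) :
    gradY i U ∘ₗ (RY i parS₁ Gp₁ U - RY i parS₂ Gp₂ U) ∘ₗ divY i U = DPDsY i parS₂ Gp₂ U - DPDsY i parS₁ Gp₁ U := by
  rw [DPDsY, DPDsY]
  simp only [LinearMap.comp_sub, LinearMap.sub_comp]
  abel

/-- **`R₁ − R₂ = −(W₁ − W₂)`** with `W := G′Q′*(Q′G′²Q′*)⁻¹Q′G′` the (3.25) word. [cite: Balaban1985BackgroundPropagators, (3.25) p.395] -/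
theorem RY_sub_RY (parS₁ parS₂ : SiteParY 𝔸 i) (Gp₁ Gp₂ : SiteOpY 𝔸 i) (U : CfgY 𝔸 i) :
    RY i parS₁ Gp₁ U - RY i parS₂ Gp₂ U =
      -(Gp₁ U ∘ₗ QpsY i parS₁ U ∘ₗ XinvY i parS₁ Gp₁ U ∘ₗ QpY i parS₁ U ∘ₗ Gp₁ U
        - Gp₂ U ∘ₗ QpsY i parS₂ U ∘ₗ XinvY i parS₂ Gp₂ U ∘ₗ QpY i parS₂ U ∘ₗ Gp₂ U) := by
  rw [RY, RY]; abel

omit [CompleteSpace 𝔸] in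
/-- **THE FIVE-TERM TELESCOPE OF THE (3.25) WORD**: `W₁ − W₂ = (G′₁−G′₂)Q′*₁X₁⁻¹Q′₁G′₁ + G′₂(Q′*₁−Q′*₂)X₁⁻¹Q′₁G′₁ + G′₂Q′*₂(X₁⁻¹−X₂⁻¹)Q′₁G′₁ + G′₂Q′*₂X₂⁻¹(Q′₁−Q′₂)G′₁
+ G′₂Q′*₂X₂⁻¹Q′₂(G′₁−G′₂)` — each summand carries exactly ONE differenced letter (priced by junction J-B: `G′` file 9, `Q′`∕`Q′*` file 5b∕8, `X⁻¹` file 23c).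
[cite: Balaban1985BackgroundPropagators, (3.25) p.395; Balaban1984PropagatorsII, (2.50) p.232, bookkeeping] -/
theorem word_sub_word_telescope (G₁ G₂ : (SiteY i → 𝔸) →ₗ[ℂ] (SiteY i → 𝔸)) (Qs₁ Qs₂ : (BlkY i → 𝔸) →ₗ[ℂ] (SiteY i → 𝔸))
    (Xi₁ Xi₂ : (BlkY i → 𝔸) →ₗ[ℂ] (BlkY i → 𝔸)) (Q₁ Q₂ : (SiteY i → 𝔸) →ₗ[ℂ] (BlkY i → 𝔸)) :
    G₁ ∘ₗ Qs₁ ∘ₗ Xi₁ ∘ₗ Q₁ ∘ₗ G₁ - G₂ ∘ₗ Qs₂ ∘ₗ Xi₂ ∘ₗ Q₂ ∘ₗ G₂ =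
      (G₁ - G₂) ∘ₗ Qs₁ ∘ₗ Xi₁ ∘ₗ Q₁ ∘ₗ G₁ + G₂ ∘ₗ (Qs₁ - Qs₂) ∘ₗ Xi₁ ∘ₗ Q₁ ∘ₗ G₁ + G₂ ∘ₗ Qs₂ ∘ₗ (Xi₁ - Xi₂) ∘ₗ Q₁ ∘ₗ G₁
        + G₂ ∘ₗ Qs₂ ∘ₗ Xi₂ ∘ₗ (Q₁ - Q₂) ∘ₗ G₁ + G₂ ∘ₗ Qs₂ ∘ₗ Xi₂ ∘ₗ Q₂ ∘ₗ (G₁ - G₂) := by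
  simp only [LinearMap.sub_comp, LinearMap.comp_sub]
  abel

/-- ★ the telescope AT THE LETTERS: `R(U; parS₁, G′₁) − R(U; parS₂, G′₂)` as minus the five-term sum. [cite: Balaban1985BackgroundPropagators, (3.25) p.395; Balaban1984PropagatorsII, (2.50) p.232] -/
theorem RY_sub_RY_telescope (parS₁ parS₂ : SiteParY 𝔸 i) (Gp₁ Gp₂ : SiteOpY 𝔸 i) (U : CfgY 𝔸 i) :
    RY i parS₁ Gp₁ U - RY i parS₂ Gp₂ U =
      -((Gp₁ U - Gp₂ U) ∘ₗ QpsY i parS₁ U ∘ₗ XinvY i parS₁ Gp₁ U ∘ₗ QpY i parS₁ U ∘ₗ Gp₁ U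
        + Gp₂ U ∘ₗ (QpsY i parS₁ U - QpsY i parS₂ U) ∘ₗ XinvY i parS₁ Gp₁ U ∘ₗ QpY i parS₁ U ∘ₗ Gp₁ U
        + Gp₂ U ∘ₗ QpsY i parS₂ U ∘ₗ (XinvY i parS₁ Gp₁ U - XinvY i parS₂ Gp₂ U) ∘ₗ QpY i parS₁ U ∘ₗ Gp₁ U
        + Gp₂ U ∘ₗ QpsY i parS₂ U ∘ₗ XinvY i parS₂ Gp₂ U ∘ₗ (QpY i parS₁ U - QpY i parS₂ U) ∘ₗ Gp₁ U
        + Gp₂ U ∘ₗ QpsY i parS₂ U ∘ₗ XinvY i parS₂ Gp₂ U ∘ₗ QpY i parS₂ U ∘ₗ (Gp₁ U - Gp₂ U)) := by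
  rw [RY_sub_RY, word_sub_word_telescope]

end Difference

/-! ## §2 The resolvent identities for `G_a = Δ_a⁻¹` at two letters and the member identity `G₁F = G₂(F − E·G₁F)` -/

section Resolvent

/-- ★ **SECOND RESOLVENT IDENTITY FOR `G_a`** (both `Δ_a`'s units): `G₁ = G₂ + G₂ ∘ (Δ₂ − Δ₁) ∘ G₁` with `Δ₂ − Δ₁ = D_U(R₂ − R₁)D*_U`:
`G_a(U; parS₁) = G_a(U; parS₂) + G_a(U; parS₂)·D_U(R₂ − R₁)D*_U·G_a(U; parS₁)`. [cite: Balaban1985BackgroundPropagators, (3.27) p.395, (3.106) p.414; Balaban1984PropagatorsII, (2.50) p.232] -/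
theorem GAY_eq_of_isUnit (parS₁ parS₂ : SiteParY 𝔸 i) (parB : BondParY 𝔸 i) (Gp₁ Gp₂ : SiteOpY 𝔸 i) (U : CfgY 𝔸 i)
    (h₁ : IsUnit (deltaAY i parS₁ parB Gp₁ U)) (h₂ : IsUnit (deltaAY i parS₂ parB Gp₂ U)) :
    GAY i parS₁ parB Gp₁ U = GAY i parS₂ parB Gp₂ U
      + GAY i parS₂ parB Gp₂ U * (gradY i U ∘ₗ (RY i parS₂ Gp₂ U - RY i parS₁ Gp₁ U) ∘ₗ divY i U) * GAY i parS₁ parB Gp₁ U := by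
  have h := inverse_eq_add_of_isUnit h₂ h₁
  rw [deltaAY_sub_deltaAY] at h
  exact h

/-- ★ the resolvent identity, other order: `G₁ = G₂ + G₁·D(R₂ − R₁)D*·G₂`. [cite: Balaban1985BackgroundPropagators, (3.27) p.395, (3.106) p.414; Balaban1984PropagatorsII, (2.50) p.232] -/
theorem GAY_eq_of_isUnit' (parS₁ parS₂ : SiteParY 𝔸 i) (parB : BondParY 𝔸 i) (Gp₁ Gp₂ : SiteOpY 𝔸 i) (U : CfgY 𝔸 i)
    (h₁ : IsUnit (deltaAY i parS₁ parB Gp₁ U)) (h₂ : IsUnit (deltaAY i parS₂ parB Gp₂ U)) :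
    GAY i parS₁ parB Gp₁ U = GAY i parS₂ parB Gp₂ U
      + GAY i parS₁ parB Gp₁ U * (gradY i U ∘ₗ (RY i parS₂ Gp₂ U - RY i parS₁ Gp₁ U) ∘ₗ divY i U) * GAY i parS₂ parB Gp₂ U := by
  have h := inverse_eq_add_of_isUnit' h₂ h₁
  rw [deltaAY_sub_deltaAY] at h
  exact h

/-- ★ **THE MEMBER IDENTITY** behind every weighted transfer: with both `Δ_a`'s units, for every source `F` the solution `A := G₁F` of `Δ₁A = F` solves
`Δ₂A = F + D_U(R₂ − R₁)D*_U A`, i.e. `G₁F = G₂(F + D_U((R₂ − R₁)(D*_U(G₁F))))` — so every bound of `G₂` applies to `G₁F` with the perturbed source.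
[cite: Balaban1985BackgroundPropagators, (3.106) p.414 («G = G₀(I − R)⁻¹»), (3.27) p.395; Balaban1985RegularSpaces, (1.59)–(1.60) p.86 (the bootstrap pattern)] -/
theorem GAY_apply_eq (parS₁ parS₂ : SiteParY 𝔸 i) (parB : BondParY 𝔸 i) (Gp₁ Gp₂ : SiteOpY 𝔸 i) (U : CfgY 𝔸 i)
    (h₁ : IsUnit (deltaAY i parS₁ parB Gp₁ U)) (h₂ : IsUnit (deltaAY i parS₂ parB Gp₂ U)) (F : FBondY i → 𝔸) :
    GAY i parS₁ parB Gp₁ U F = GAY i parS₂ parB Gp₂ U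
      (F + gradY i U ((RY i parS₂ Gp₂ U - RY i parS₁ Gp₁ U) (divY i U (GAY i parS₁ parB Gp₁ U F)))) := by
  have h := GAY_eq_of_isUnit i parS₁ parS₂ parB Gp₁ Gp₂ U h₁ h₂
  conv_lhs => rw [h]
  simp only [Module.End.mul_apply, LinearMap.add_apply, LinearMap.comp_apply, map_add]

end Resolvent

/-! ## §3 Invertibility transfer: `Δ₂` a unit and `1 + G₂E` a unit ⇒ `Δ₂ + E` a unit; on the finite carrier a trivial kernel suffices -/

section Unit

/-- **FACTORISATION** `Δ₂ + E = Δ₂·(1 + G₂E)` for a unit `Δ₂`, `G₂ = Δ₂⁻¹` (any ring). [cite: Balaban1985BackgroundPropagators, (3.106) p.414, bookkeeping] -/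
theorem add_eq_mul_one_add_inverse {R₀ : Type*} [Ring R₀] {T E : R₀} (h : IsUnit T) : T + E = T * (1 + Ring.inverse T * E) := by
  rw [mul_add, mul_one, ← mul_assoc, Ring.mul_inverse_cancel _ h, one_mul]

/-- ★ **INVERTIBILITY TRANSFER** (any ring): `T` a unit and `1 + T⁻¹E` a unit ⇒ `T + E` a unit — print's «G = G₀(I − R)⁻¹ … R is an operator with small norm».
[cite: Balaban1985BackgroundPropagators, (3.106) p.414, Thm 3.11 p.416] -/
theorem isUnit_add_of_isUnit {R₀ : Type*} [Ring R₀] {T E : R₀} (h : IsUnit T) (h1 : IsUnit (1 + Ring.inverse T * E)) : IsUnit (T + E) := by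
  rw [add_eq_mul_one_add_inverse h]; exact h.mul h1

/-- ★ **AT TWO LETTERS**: `Δ_a(U; parS₂)` a unit and `1 + G_a(U; parS₂)·D_U(R₁ − R₂)D*_U` a unit ⇒ `Δ_a(U; parS₁)` a unit.
[cite: Balaban1985BackgroundPropagators, (3.26)–(3.27) p.395, (3.106) p.414, Thm 3.11 p.416] -/
theorem isUnit_deltaAY_of_isUnit (parS₁ parS₂ : SiteParY 𝔸 i) (parB : BondParY 𝔸 i) (Gp₁ Gp₂ : SiteOpY 𝔸 i) (U : CfgY 𝔸 i)
    (h₂ : IsUnit (deltaAY i parS₂ parB Gp₂ U))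
    (h1 : IsUnit (1 + GAY i parS₂ parB Gp₂ U * (gradY i U ∘ₗ (RY i parS₁ Gp₁ U - RY i parS₂ Gp₂ U) ∘ₗ divY i U))) :
    IsUnit (deltaAY i parS₁ parB Gp₁ U) := by
  have h : deltaAY i parS₁ parB Gp₁ U = deltaAY i parS₂ parB Gp₂ U + gradY i U ∘ₗ (RY i parS₁ Gp₁ U - RY i parS₂ Gp₂ U) ∘ₗ divY i U := by
    rw [← deltaAY_sub_deltaAY]; abel
  rw [h]
  exact isUnit_add_of_isUnit h₂ h1

omit [CompleteSpace 𝔸] in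
/-- **ON A FINITE-DIMENSIONAL CARRIER A TRIVIAL KERNEL IS INVERTIBILITY** (Mathlib's `LinearMap.isUnit_iff_ker_eq_bot`, stated for the bond fields; the device behind
print's «symmetric and invertible» and behind every Neumann-series invertibility of the cell). [cite: Balaban1985BackgroundPropagators, Thm 3.11 p.416, bookkeeping] -/
theorem isUnit_of_forall_eq_zero [FiniteDimensional ℂ 𝔸] {T : Module.End ℂ (FBondY i → 𝔸)} (h : ∀ A, T A = 0 → A = 0) : IsUnit T := by
  rw [LinearMap.isUnit_iff_ker_eq_bot, LinearMap.ker_eq_bot']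
  exact h

/-- ★ **`1 + G₂E` IS A UNIT AS SOON AS `(1 + G₂E)A = 0 ⇒ A = 0`** on the finite carrier — the form every weighted-norm smallness argument delivers.
[cite: Balaban1985BackgroundPropagators, (3.106) p.414, Thm 3.11 p.416] -/
theorem isUnit_deltaAY_of_kernel [FiniteDimensional ℂ 𝔸] (parS₁ parS₂ : SiteParY 𝔸 i) (parB : BondParY 𝔸 i) (Gp₁ Gp₂ : SiteOpY 𝔸 i) (U : CfgY 𝔸 i)
    (h₂ : IsUnit (deltaAY i parS₂ parB Gp₂ U))
    (hker : ∀ A : FBondY i → 𝔸,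
      A + GAY i parS₂ parB Gp₂ U (gradY i U ((RY i parS₁ Gp₁ U - RY i parS₂ Gp₂ U) (divY i U A))) = 0 → A = 0) :
    IsUnit (deltaAY i parS₁ parB Gp₁ U) := by
  refine isUnit_deltaAY_of_isUnit i parS₁ parS₂ parB Gp₁ Gp₂ U h₂ (isUnit_of_forall_eq_zero i fun A hA => hker A ?_)
  simpa [Module.End.mul_apply, LinearMap.comp_apply] using hA

end Unit

end Literature.MathematicalPhysics.QuantumFieldTheory.Balaban1983to89.B9B8KnitBondResolvent

end
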